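import Literature.InformationTheory.QuantumCodes.ToricCodeErasureThreshold
import Literature.Probability.Percolation.SharpnessDCTProofs
import HarnessLib

/-!
# Toric-code losses and square-lattice bond percolation, I: an uncorrectable loss pattern joins a
# site to the boundary of a box of radius `⌊(L-1)/2⌋` in the lifted percolation configuration

Topic `Literature/InformationTheory/QuantumCodes` (venture QEC, LADDER-QEC rung Q5 — the EXACT loss threshold
`y_c = 1/2` of the toric code; qec-type-03). First of two theorem files (all PROVED, no named fact, kernel axioms)
supplying the dictionary between the loss-decoding criterion of the `L × L` toric code
(`IsCorrectableErasure (cycles L) (boundaries L)`, `ErasureDecoding.lean` / `ToricCodeErasureThreshold.lean`: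
a loss pattern is uncorrectable iff the lost links support a homologically non-trivial cycle) and Bernoulli
bond percolation on `ℤ²` (`Literature/Probability/Percolation`: `bondPercolation (zdGraph 2) p`, the one-arm
event `siteToBoundary 2 n = {0 ↔ ∂B(n) in B(n)}`), whose subcritical exponential decay below `p_c(ℤ²) = 1/2`
is PROVED in the tree (`Kesten1980_expDecay`, `kesten_criticalProb_Z2_holds`, `KestenTheoremProofs.lean`).
This is the percolation step of Stace–Barrett–Doherty's argument ("if `p_loss` is too high, there is likely to
be a percolated region of losses spanning the entire lattice … for `p_loss < 0.5` loss recovery almost surely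
succeeds", PRL 102 (2009) 200501, p. 2–3), made finite and one-armed:

* `mem_boundaries_of_empty_column_row` — the column/row form of the cut-open-torus lemma of
  `ToricCodeCycles.lean`: a cycle of the toric code avoiding some column of links and some row of links is a
  boundary (so a homologically NON-trivial cycle meets every column or meets every row);
* `exists_natAbs_traj_ge` — hence a non-trivial self-avoiding polygon (`IsPolygon v w`,
  `ToricCodePolygons.lean`), lifted to `ℤ²` along its step word (`Word.traj w`), reaches sup-norm distance `≥ n`
  from its start whenever `2n + 1 ≤ L`;
* `liftConfig v Er` — the bond configuration of `ℤ²` in which the link `{x, x + eᵢ}` is open iff the torus link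
  `(v + x mod L, i)` is lost (the periodic lift of the loss pattern, re-centred at the site `v`);
* **`exists_liftConfig_mem_siteToBoundary`** — for `L ≥ 3` and `2n + 1 ≤ L`, an UNCORRECTABLE loss pattern `Er`
  puts `liftConfig v Er` in the one-arm event `{0 ↔ ∂B(n) in B(n)}` for some site `v` (follow the lifted
  polygon from its start to its first exit from the box of radius `n`).

The probabilistic half (the loss law seen through `liftConfig v` on the box IS bond percolation; union bound
over the `L²` centres; `y_c = 1/2`) is `ToricCodeErasureHalf.lean`.

## References

* [StaceBarrettDoherty2009] T. M. Stace, S. D. Barrett, A. C. Doherty, *Thresholds for topological codes in the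
  presence of loss*, PRL 102 (2009) 200501, arXiv:0904.3556, p. 2–3 (loss criterion: a homologically nontrivial
  cycle avoiding the lost qubits; percolated region of losses; `p_loss < 0.5`).
* [KestenCMP1980] H. Kesten, *The critical probability of bond percolation on the square lattice equals 1/2*,
  Comm. Math. Phys. 74 (1980) 41–59, Thm. 2 (1.7) (exponential decay of the radius of the open cluster for
  `p < 1/2`) — via the tree's `Kesten1980_expDecay`.
* [DennisEtAl2002] Dennis–Kitaev–Landahl–Preskill, J. Math. Phys. 43 (2002) 4452, §3.1, §5.2 (cycles on the
  torus; self-avoiding polygons) — via the tree's toric-code files.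
-/

namespace Literature.InformationTheory.QuantumCodes

namespace ToricCode

open Finset Matrix
open Literature.Probability.LatticeModels (TorusSite Site Torus.proj box zdGraph innerBoundary mem_box zero_mem_box)
open Literature.Probability.Percolation (stepVec BondConfig openGraph openGraph_adj siteToBoundary PathIn)
open Literature.Probability.RandomPlanarGeometry.SAW.Zd

variable {L : ℕ}

/-! ### A cycle missing a column and a row is a boundary -/

/-- **Column/row form of the cut-open-torus lemma**: a cycle of the `L × L` toric code none of whose links
starts in the column `v₀ = a₀` and none in the row `v₁ = b₀` is a boundary (it lives on the torus cut open
along two dual loops, a planar region; `ToricCodeCycles.lean`, translated so that the empty lines are at `-1`).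
Contrapositively: a homologically non-trivial cycle has a link in every column or a link in every row.
[cite: DennisEtAl2002, §3.1 ("a homologically nontrivial cycle … must wind around the torus")] -/
theorem mem_boundaries_of_empty_column_row [NeZero L] {z : Chain L} (hz : z ∈ cycles L)
    {a₀ b₀ : ZMod L} (ha₀ : ∀ (v : Vertex L) (i : Fin 2), v 0 = a₀ → z (v, i) = 0)
    (hb₀ : ∀ (v : Vertex L) (i : Fin 2), v 1 = b₀ → z (v, i) = 0) : z ∈ boundaries L :=
  -- Proof repaired 2026-08-28 (qec-lit-3 g9, director-qec R113): since p561605 `ToricCodeCycles.lean` exports the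
  -- sharper public lemma `mem_boundaries_of_emptyCol_emptyRow` (only HORIZONTAL links of the column and VERTICAL
  -- links of the row need to vanish); this statement is its specialisation, so the former `open private` route
  -- through the core lemma is no longer needed. Statement unchanged.
  mem_boundaries_of_emptyCol_emptyRow hz (fun v hv => ha₀ v 0 hv) (fun v hv => hb₀ v 1 hv)

/-! ### The lift of a torus polygon to `ℤ²` -/

/-- Coordinates of the torus path: `(tpos v w k)ⱼ = vⱼ + (Word.traj w k)ⱼ mod L`.
[cite: DennisEtAl2002, §5.2 (lattice paths on the torus)] -/
theorem tpos_apply (v : Vertex L) (w : List (Fin 2 × Bool)) (k : ℕ) (j : Fin 2) :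
    tpos v w k j = v j + ((Word.traj w k j : ℤ) : ZMod L) := by
  simp [tpos]

/-- For `k < |w|` the link of step `k` is the link of the letter `w[k]` from the site `tpos v w k`.
[cite: DennisEtAl2002, §5.2 (links of a lattice path)] -/
theorem edgeAt_eq_stepEdge (v : Vertex L) (w : List (Fin 2 × Bool)) {k : ℕ} (hk : k < w.length) :
    edgeAt v w k = stepEdge (tpos v w k) w[k] := by
  rw [edgeAt, List.getD_eq_getElem?_getD, List.getElem?_eq_getElem hk, Option.getD_some]

/-- The base site of the link of step `k` is `tpos v w k` (forward step) or `tpos v w k - eᵢ` (backward step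
along axis `i`). [cite: DennisEtAl2002, §5.2 (links of a lattice path)] -/
theorem edgeAt_fst_eq (v : Vertex L) (w : List (Fin 2 × Bool)) {k : ℕ} (hk : k < w.length) :
    (edgeAt v w k).1 = tpos v w k ∨ (edgeAt v w k).1 = tpos v w k - dir (w[k]).1 := by
  rw [edgeAt_eq_stepEdge v w hk, stepEdge]
  split_ifs <;> simp

/-- The `j`-th coordinate of the base site of the link of step `k` is `vⱼ + ((Word.traj w k)ⱼ - δ) mod L`
with `δ ∈ {0, 1}`. [cite: DennisEtAl2002, §5.2 (links of a lattice path)] -/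
theorem exists_edgeAt_fst_apply (v : Vertex L) (w : List (Fin 2 × Bool)) {k : ℕ} (hk : k < w.length)
    (j : Fin 2) :
    ∃ δ : ℤ, (δ = 0 ∨ δ = 1) ∧ (edgeAt v w k).1 j = v j + ((Word.traj w k j - δ : ℤ) : ZMod L) := by
  rcases edgeAt_fst_eq v w hk with h | h
  · refine ⟨0, Or.inl rfl, ?_⟩
    rw [h, tpos_apply, sub_zero]
  · refine ⟨if j = (w[k]).1 then 1 else 0, by split_ifs <;> simp, ?_⟩
    rw [h, Pi.sub_apply, tpos_apply, dir, Pi.single_apply]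
    split_ifs <;> push_cast <;> ring

/-- **A non-trivial polygon's lift leaves the box of radius `n`** (`2n + 1 ≤ L`): if `IsPolygon v w` carries a
homologically non-trivial cycle then some site of the lifted walk `Word.traj w` has a coordinate of absolute
value `≥ n`. (Otherwise all lifted sites have both coordinates in `(-n, n)`, so the links of the polygon avoid
the column `v₀ + n` and the row `v₁ + n` — `2n < L` — and the polygon bounds, by
`mem_boundaries_of_empty_column_row`.) [cite: StaceBarrettDoherty2009, p. 2 (a percolated region of losses spanning the lattice)] -/
theorem exists_natAbs_traj_ge [NeZero L] {n : ℕ} (hn : 2 * n + 1 ≤ L) {v : Vertex L}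
    {w : List (Fin 2 × Bool)} (hP : IsPolygon v w) (hnb : polygonChain v w ∉ boundaries L) :
    ∃ i ≤ w.length, ∃ j : Fin 2, n ≤ (Word.traj w i j).natAbs := by
  classical
  by_contra hcon
  push Not at hcon
  apply hnb
  -- the links of the polygon avoid the column `v 0 + n` and the row `v 1 + n`
  have key : ∀ (j : Fin 2) (u : Vertex L) (i : Fin 2), u j = v j + (n : ZMod L) →
      polygonChain v w (u, i) = 0 := by
    intro j u i hu
    by_contra hne
    have hmem : (u, i) ∈ supp (polygonChain v w) := by simp [supp, hne]
    rw [supp_polygonChain hP.edgeAt_injOn, polygonEdges, Finset.mem_image] at hmem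
    obtain ⟨k, hk, hku⟩ := hmem
    rw [Finset.mem_range] at hk
    obtain ⟨δ, hδ, hcoord⟩ := exists_edgeAt_fst_apply v w hk j
    rw [hku] at hcoord
    change u j = _ at hcoord
    rw [hu] at hcoord
    have h1 : ((Word.traj w k j - δ - n : ℤ) : ZMod L) = 0 := by
      have h2 := add_left_cancel hcoord
      push_cast at h2 ⊢
      rw [← h2]
      ring
    rw [ZMod.intCast_zmod_eq_zero_iff_dvd] at h1
    obtain ⟨c, hc⟩ := h1
    have hlt := hcon k hk.le j
    have hb : -(2 * n : ℤ) ≤ Word.traj w k j - δ - n ∧ Word.traj w k j - δ - n ≤ -1 := by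
      rcases hδ with rfl | rfl <;> omega
    have hL : (2 * n + 1 : ℤ) ≤ L := by exact_mod_cast hn
    rcases le_or_gt 0 c with hc0 | hc0
    · have : 0 ≤ (L : ℤ) * c := mul_nonneg (by positivity) hc0
      linarith [hb.2]
    · have : (L : ℤ) * c ≤ (L : ℤ) * (-1) := by
        exact mul_le_mul_of_nonneg_left (by omega) (by positivity)
      linarith [hb.1]
  exact mem_boundaries_of_empty_column_row (polygonChain_mem_cycles hP.closed)
    (fun u i hu => key 0 u i hu) (fun u i hu => key 1 u i hu)

/-! ### The lifted loss configuration around a site -/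

/-- **The lift of a loss pattern around the site `v`**: the bond configuration of `ℤ²` in which the link
`{x, x + eᵢ}` is open iff the torus link `(v + (x mod L), i)` is lost — the periodic lift of the lost links,
re-centred at `v`. [cite: StaceBarrettDoherty2009, p. 2 (lost qubits as deleted/percolating bonds of the lattice)] -/
def liftConfig (v : Vertex L) (Er : Finset (Edge L)) : BondConfig (Site 2) :=
  {e | ∃ (x : Site 2) (i : Fin 2), e = s(x, x + Pi.single i 1) ∧ (v + Torus.proj L x, i) ∈ Er}

/-- Reduction `ℤ² → ℤ_L²` is additive. [folklore] -/
private theorem proj_add' (x y : Site 2) : (Torus.proj L (x + y) : Vertex L) = Torus.proj L x + Torus.proj L y := by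
  ext i; simp [Torus.proj]

/-- Reduction `ℤ² → ℤ_L²` commutes with subtraction. [folklore] -/
private theorem proj_sub' (x y : Site 2) : (Torus.proj L (x - y) : Vertex L) = Torus.proj L x - Torus.proj L y := by
  ext i; simp [Torus.proj]

/-- The reduction of the unit vector `eᵢ` is the torus unit vector `eᵢ`. [folklore] -/
private theorem proj_single' (i : Fin 2) : (Torus.proj L (Pi.single i (1 : ℤ)) : Vertex L) = dir i := by
  ext j
  by_cases h : j = i
  · subst h; simp [Torus.proj, dir]
  · simp [Torus.proj, dir, h]

/-- **The step links lift to open bonds**: if the torus link of the letter `a` from the site `v + (x mod L)` is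
lost, the bond `{x, x + stepVec a}` of `ℤ²` is open in `liftConfig v Er`.
[cite: StaceBarrettDoherty2009, p. 2 (lost qubits as bonds)] -/
theorem stepSym2_mem_liftConfig (v : Vertex L) (Er : Finset (Edge L)) (x : Site 2) (a : Fin 2 × Bool)
    (h : stepEdge (v + Torus.proj L x) a ∈ Er) : s(x, x + stepVec a) ∈ liftConfig v Er := by
  obtain ⟨i, b⟩ := a
  cases b
  · -- backward step: the bond `{x - eᵢ, x}` with torus base site `v + (x mod L) - eᵢ`
    refine ⟨x - Pi.single i 1, i, ?_, ?_⟩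
    · rw [sub_add_cancel, Sym2.eq_swap]
      simp [stepVec, sub_eq_add_neg]
    · have e : v + Torus.proj L (x - Pi.single i 1) = v + Torus.proj L x - dir i := by
        rw [proj_sub', proj_single', add_sub_assoc]
      rw [e]
      simpa [stepEdge] using h
  · refine ⟨x, i, by simp [stepVec], ?_⟩
    simpa [stepEdge] using h

/-- The lost links of a path lift to open bonds between consecutive lifted sites: for `k < |w|` with
`edgeAt v w k` lost, `{Word.traj w k, Word.traj w (k+1)}` is open in `liftConfig v Er`.
[cite: StaceBarrettDoherty2009, p. 2 (lost qubits as bonds)] -/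
theorem traj_sym2_mem_liftConfig (v : Vertex L) (Er : Finset (Edge L)) (w : List (Fin 2 × Bool)) {k : ℕ}
    (hk : k < w.length) (h : edgeAt v w k ∈ Er) :
    s(Word.traj w k, Word.traj w (k + 1)) ∈ liftConfig v Er := by
  rw [Word.traj_succ w hk]
  refine stepSym2_mem_liftConfig v Er _ _ ?_
  rw [edgeAt_eq_stepEdge v w hk] at h
  exact h

/-- **The lifted path is open**: if the first `m ≤ |w|` links of the path are lost and its first `m + 1` lifted
sites lie in the box `B(n)`, the lifted sites `0 = Word.traj w 0, …, Word.traj w m` form an open path of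
`liftConfig v Er` inside `B(n)`. [cite: StaceBarrettDoherty2009, p. 2 (percolated region of losses)] -/
theorem pathIn_liftConfig (v : Vertex L) (Er : Finset (Edge L)) (w : List (Fin 2 × Bool)) (n : ℕ) :
    ∀ m ≤ w.length, (∀ k < m, edgeAt v w k ∈ Er) → (∀ k ≤ m, Word.traj w k ∈ box 2 n) →
      PathIn (openGraph (liftConfig v Er)) ↑(box 2 n) 0 (Word.traj w m) := by
  intro m
  induction m with
  | zero =>
    intro _ _ _
    rw [Word.traj_zero]
    exact PathIn.refl (Finset.mem_coe.2 (zero_mem_box 2 n))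
  | succ m ih =>
    intro hm hE hB
    have ih' := ih (Nat.le_of_succ_le hm) (fun k hk => hE k (Nat.lt_succ_of_lt hk))
      (fun k hk => hB k (Nat.le_succ_of_le hk))
    refine ih'.tail ?_ (Finset.mem_coe.2 (hB (m + 1) le_rfl))
    rw [openGraph_adj]
    exact ⟨traj_sym2_mem_liftConfig v Er w hm (hE m (Nat.lt_succ_self m)), (Word.adj_traj_succ w hm).ne⟩

/-- A unit step changes each coordinate by at most one. [folklore] -/
private theorem natAbs_stepVec_apply_le (a : Fin 2 × Bool) (j : Fin 2) : (stepVec a j).natAbs ≤ 1 := by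
  obtain ⟨i, b⟩ := a
  cases b <;> by_cases h : j = i <;> simp [stepVec, h]

/-! ### Uncorrectable loss patterns produce a one-arm event -/

/-- **First exit of a non-trivial polygon**: under `2n + 1 ≤ L`, a non-trivial self-avoiding polygon `(v, w)`
has a time `i₀ ≤ |w|` at which its lift sits on the inner boundary `∂B(n)` of the box of radius `n`, all
earlier (and the current) lifted sites lying in `B(n)`.
[cite: StaceBarrettDoherty2009, p. 2 (a percolated region of losses spanning the lattice)] -/
theorem exists_first_exit [NeZero L] {n : ℕ} (hn : 2 * n + 1 ≤ L) {v : Vertex L} {w : List (Fin 2 × Bool)}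
    (hP : IsPolygon v w) (hnb : polygonChain v w ∉ boundaries L) :
    ∃ i₀ ≤ w.length, Word.traj w i₀ ∈ innerBoundary (zdGraph 2) (box 2 n) ∧
      ∀ k ≤ i₀, Word.traj w k ∈ box 2 n := by
  classical
  have hex : ∃ i, i ≤ w.length ∧ ∃ j : Fin 2, n ≤ (Word.traj w i j).natAbs := by
    obtain ⟨i, hi, j, hj⟩ := exists_natAbs_traj_ge hn hP hnb
    exact ⟨i, hi, j, hj⟩
  set i₀ := Nat.find hex with hi₀
  obtain ⟨hi₀le, j₀, hj₀⟩ := Nat.find_spec hex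
  have hbefore : ∀ k < i₀, ∀ j : Fin 2, (Word.traj w k j).natAbs < n := by
    intro k hk j
    by_contra hge
    exact Nat.find_min hex hk ⟨le_trans hk.le hi₀le, j, not_lt.1 hge⟩
  -- the lifted site at time `i₀` is still in the box (one unit step from a site of sup-norm `< n`)
  have hat : ∀ j : Fin 2, (Word.traj w i₀ j).natAbs ≤ n := by
    intro j
    rcases Nat.eq_zero_or_pos i₀ with h0 | hpos
    · rw [h0]
      simp
    · obtain ⟨k', hk'⟩ : ∃ k', i₀ = k' + 1 := ⟨i₀ - 1, by omega⟩
      have hk'lt : k' < w.length := by omega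
      rw [hk', Word.traj_succ w hk'lt, Pi.add_apply]
      have h1 := hbefore k' (by omega) j
      have h2 := natAbs_stepVec_apply_le (w[k']) j
      omega
  -- every lifted site up to time `i₀` lies in the box
  have hbox : ∀ k ≤ i₀, Word.traj w k ∈ box 2 n := by
    intro k hk
    rw [mem_box]
    intro j
    rcases Nat.lt_or_ge k i₀ with hlt | hge
    · have := hbefore k hlt j
      omega
    · rw [le_antisymm hk hge]
      have := hat j
      omega
  refine ⟨i₀, hi₀le, ?_, hbox⟩
  -- at time `i₀` some coordinate has absolute value exactly `n`
  exact Literature.Probability.Percolation.DCT16.mem_innerBoundary_box_of_natAbs_eq (hbox i₀ le_rfl)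
    (le_antisymm (hat j₀) hj₀)

/-- **An uncorrectable loss pattern of the `L × L` toric code (`L ≥ 3`) produces a one-arm event**: for every
box radius `n` with `2n + 1 ≤ L` there is a site `v` such that, in the lifted configuration `liftConfig v Er`,
the origin is joined to `∂B(n)` by an open path inside `B(n)` (`siteToBoundary 2 n`). Proof: the lost links
support a homologically non-trivial cycle, hence a non-trivial self-avoiding polygon
(`exists_polygon_not_mem_boundaries`); follow its lift from its start site `v` to its first exit from `B(n)`.
[cite: StaceBarrettDoherty2009, p. 2–3 (uncorrectable losses ⇒ a percolated region of losses)] -/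
theorem exists_liftConfig_mem_siteToBoundary [NeZero L] (hL : 3 ≤ L) {n : ℕ} (hn : 2 * n + 1 ≤ L)
    {Er : Finset (Edge L)} (hEr : ¬ IsCorrectableErasure (cycles L) (boundaries L) Er) :
    ∃ v : Vertex L, liftConfig v Er ∈ siteToBoundary 2 n := by
  unfold IsCorrectableErasure at hEr
  push Not at hEr
  obtain ⟨z, hz, hzE, hzb⟩ := hEr
  obtain ⟨v, w, hP, hsub, hnb⟩ := exists_polygon_not_mem_boundaries hL hz hzb
  obtain ⟨i₀, hi₀, hbdry, hbox⟩ := exists_first_exit hn hP hnb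
  refine ⟨v, ?_⟩
  rw [Literature.Probability.Percolation.DCT16.mem_siteToBoundary_iff]
  refine ⟨Word.traj w i₀, hbdry, pathIn_liftConfig v Er w n i₀ hi₀ (fun k hk => ?_) hbox⟩
  exact hzE (hsub (Finset.mem_image.2 ⟨k, Finset.mem_range.2 (lt_of_lt_of_le hk hi₀), rfl⟩))

end ToricCode

end Literature.InformationTheory.QuantumCodes
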